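import Summits.BirchSwinnertonDyer.BirchSwinnertonDyer.Theorems.QuadraticBranchSignedControlPlusEtaNonsurjThetaFunctionalEquationParityFactFree
import Literature.NumberTheory.EllipticCurves.QuadraticTwistKroneckerRootNumberProofs
import Literature.NumberTheory.EllipticCurves.BSDRootNumberModularityOnlyProofs
import HarnessLib

/-!
# Route `QuadraticBranchSignedControl` (rung K8, cell `bsd-potss`), residual crux `PlusEtaMainConjectureNonsurj`
# (stmt-BirchSwinnertonDyer-19606): THE FUNCTIONAL EQUATION ON THE QUADRATIC BRANCH, XIV — THE SIGN IS THE ROOT NUMBER OF THE ADDITIVE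
# TWIST: `(−1)^{λ(L_p^±(V,η,X))} = (−1)^{ord_T} = w(V^{(p*)})` and `λ ≡ ord_T ≡ r_an(V^{(p*)}) (mod 2)`, modulo Modularity only
# (seat `bsd-potss-k8eta-c2` g28; kernel, class-wide)

WHY. Parts V–VII / XII proved `(−1)^{λ(L)} = (−1)^{ord_T L} = w_V·(−N_V | p)` for every nonzero branch function `L = L_p^±(V, η, X)` of a
row `V` (good at `p ≥ 5`, `a_p(V) = 0`, newform at level `N_V`), fact-free. The right-hand side is the ROOT NUMBER OF THE ADDITIVE TWIST
`W = V^{(p*)}`, `p* = (−1)^{(p−1)/2}p` — the curve whose `BSD_p` the K8 rung is about: the tree's twisting law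
`rootNumber_quadraticTwist_of_emod_four_eq_one` (Murty–Murty Ch. 6 §1 / Atkin–Lehner §6, from Modularity) gives
`w(V^{(p*)}) = (−1 | p)·(N_V | p)·w_V = w_V·(−N_V | p)` (`p* ≡ 1 (mod 4)`, `p ∤ N_V`). THIS FILE records (§30) the sign identity and (§31) **`(−1)^{λ(L_p^±(V,η,X))} = (−1)^{ord_T L_p⁺(V,η,X)} = w(V^{(p*)})`**
and, with the parity consequence of the complex functional equation of `V^{(p*)}` (`even_analyticRank_iff_rootNumber_eq_one_of_exists_isNewformOf`,
also from Modularity alone), **`λ(L_p^±(V, η, X)) ≡ ord_{T=0} L_p⁺(V, η, X) ≡ r_an(V^{(p*)}) (mod 2)`** — the `p`-adic (η-branch) and complex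
orders agree modulo `2` at an additive potentially supersingular prime, and `r_an(V^{(p*)})` odd forces `L_p⁺(V, η, 0) = 0`. ONE named fact
in hypothesis position: the Modularity Theorem `exists_isNewformOf` (`hmod`), as everywhere the programme speaks of `w(E)` / `r_an(E)`.

WHAT. §30 `jacobiSym_neg_one_mul_jacobiSym_eq_legendreSym_neg`, **`rootNumber_quadraticTwist_pStar`** (`w(V^{(p*)}) = w_V·(−N_V | p)`, `hmod`);
§31 **`neg_one_pow_lam_plus_eq_rootNumber_twist`**, `neg_one_pow_lam_minus_eq_rootNumber_twist`, `neg_one_pow_order_plus_eq_rootNumber_twist`,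
**`even_lam_plus_iff_even_analyticRank_twist`**, `even_lam_minus_iff_even_analyticRank_twist`, `even_order_plus_iff_even_analyticRank_twist`,
`constantCoeff_plus_eq_zero_of_odd_analyticRank_twist`.

HONEST FRAMING (cell `bsd-potss`; FULL-BSD rank ≤ 1 programme, HUMAN RULING D-0036/D-0074): TOOL THEOREMS ONLY, CONDITIONAL on the
Modularity Theorem `exists_isNewformOf` in hypothesis position (`hmod`; no other named fact; none minted); no definition, no `sorry`, axioms
standard; nothing about (A), (C1⁺_η), C-cc-1 or `BSD(W,p)` of any pair is claimed; no stub of 19606 is proved; crux and route OPEN; nothing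
booked. `--supports stmt-BirchSwinnertonDyer-19606`.

References: [MurtyMurty1997] Ch. 6 §1; [AtkinLehner1970] §6 and Thm. 3; [SilvermanAEC2009] C.16 Thm. 16.3 and remark (p. 451);
[BCDTJAMS2001] Thm. A; [GreenbergLNM1716] §5 (p. 181: "the 'signs' … are the same"); [MazurTateTeitelbaum1986Invent] §I.17;
[Kobayashi2003] Thm. 3.2, (3.4)–(3.6). Tree: Parts VII, XII; `QuadraticTwistKroneckerRootNumberProofs`, `BSDRootNumberModularityOnlyProofs`.
-/

set_option autoImplicit false
set_option linter.dupNamespace false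
noncomputable section

open scoped Classical MatrixGroups ModularForm NumberTheorySymbols

open CongruenceSubgroup Polynomial WeierstrassCurve Literature.NumberTheory.EllipticCurves
  Literature.NumberTheory.EllipticCurves.ModularForms
open Literature.NumberTheory.EllipticCurves.IwasawaAlgebra
open Summit.BirchSwinnertonDyer.Rank1Residual.Additive
open Summit.BirchSwinnertonDyer.Rank1Residual.X1.MuLambda (lam)

namespace Summit.BirchSwinnertonDyer.BirchSwinnertonDyer.Theorems.EtaThetaFunctionalEquation

variable {p : ℕ} [hp : Fact p.Prime]

/-! ## §30 `p* = (−1)^{(p−1)/2}·p`: `p* ≡ 1 (mod 4)`, squarefree, prime to `N_V`; `w(V^{(p*)}) = w_V·(−N_V | p)` -/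

/-- `(−1 | p)·(N | p) = (−N | p)` (Jacobi symbols at the prime `p` are Legendre symbols). [folklore] -/
theorem jacobiSym_neg_one_mul_jacobiSym_eq_legendreSym_neg (N : ℕ) :
    J(-1 | p) * J((N : ℤ) | p) = legendreSym p (-(N : ℤ)) := by
  rw [← jacobiSym.legendreSym.to_jacobiSym, ← jacobiSym.legendreSym.to_jacobiSym, ← legendreSym.mul, neg_one_mul]

section Root

variable {V : WeierstrassCurve ℚ} [V.IsElliptic]

/-- **`w(V^{(p*)}) = w_V · (−N_V | p)`** for `p ∤ N_V` (odd prime `p`, `p* = (−1)^{⌊p/2⌋}p`), from the tree's twisting law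
`rootNumber_quadraticTwist_of_emod_four_eq_one` (Modularity `hmod`; `p* ≡ 1 (mod 4)` squarefree and prime to `N_V` — cf. the tree's
`RamifiedHabitat.pStar_emod_four`, `ThreeFieldRoadSupply.squarefree_pStar` / `natAbs_pStar`, re-derived inline to keep the import closure
small): the sign `σ·(−N | p)` of the functional equation on the quadratic branch IS the root number of the additive twist.
[cite: MurtyMurty1997, Ch. 6 §1 (functional equation of L_D(s, f))] [cite: AtkinLehner1970, §6] -/
theorem rootNumber_quadraticTwist_pStar (hmod : exists_isNewformOf) (hp2 : p ≠ 2) (hpN : ¬ p ∣ V.conductorNorm ℤ) :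
    (V.quadraticTwist ((((-1 : ℤ) ^ (p / 2) * p : ℤ)) : ℚ)).rootNumber = V.rootNumber * legendreSym p (-(V.conductorNorm ℤ : ℤ)) := by
  have hP : p.Prime := hp.out
  have habs : ((-1 : ℤ) ^ (p / 2) * p).natAbs = p := by
    rw [Int.natAbs_mul, Int.natAbs_pow, Int.natAbs_neg, Int.natAbs_one, one_pow, one_mul, Int.natAbs_natCast]
  have h4 : ((-1 : ℤ) ^ (p / 2) * p) % 4 = 1 := by
    have hodd : p % 2 = 1 := hP.eq_two_or_odd.resolve_left hp2
    rcases Nat.even_or_odd (p / 2) with ⟨j, hj⟩ | ⟨j, hj⟩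
    · rw [Even.neg_one_pow ⟨j, hj⟩, one_mul]; omega
    · rw [Odd.neg_one_pow ⟨j, hj⟩, neg_one_mul]; omega
  have hsq : Squarefree ((-1 : ℤ) ^ (p / 2) * p) := by
    rw [← Int.squarefree_natAbs, habs]; exact hP.squarefree
  have hgcd : Int.gcd ((-1 : ℤ) ^ (p / 2) * p) (V.conductorNorm ℤ : ℤ) = 1 := by
    rw [Int.gcd_eq_natAbs, habs, Int.natAbs_natCast]; exact (Nat.Prime.coprime_iff_not_dvd hP).mpr hpN
  have h := (V.rootNumber_quadraticTwist_of_emod_four_eq_one hmod h4 hsq hgcd).1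
  rw [h, habs, jacobiSym_neg_one_mul_jacobiSym_eq_legendreSym_neg, mul_comm]

end Root

/-! ## §31 `(−1)^{λ} = (−1)^{ord_T} = w(V^{(p*)})` and `λ ≡ ord_T ≡ r_an(V^{(p*)}) (mod 2)` (Modularity only) -/

section Twist

variable {V : WeierstrassCurve ℚ} [V.IsElliptic] [NeZero (V.conductorNorm ℤ)]
  {f : CuspForm (Gamma0 (V.conductorNorm ℤ)) 2} [V.IsGloballyMinimal]

/-- **`(−1)^{λ(L_p⁺(V, η, X))} = w(V^{(p*)})`**: `V` globally minimal, good at `p ≥ 5`, `a_p(V) = 0`, `f` its newform at level `N_V`, any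
period ratio `ϖ`, every NONZERO plus branch function `Lη`; Modularity `hmod` (for the twisting law). The λ-invariant of Kobayashi's
`L_p⁺(V, η, X)` has the parity of the sign of the functional equation of `L(V^{(p*)}, s)`. [cite: MazurTateTeitelbaum1986Invent, §I.17]
[cite: MurtyMurty1997, Ch. 6 §1] [cite: Kobayashi2003, Thm. 3.2, (3.4)] [cite: GreenbergLNM1716, §5 (p. 181)] -/
theorem neg_one_pow_lam_plus_eq_rootNumber_twist (hmod : exists_isNewformOf) (hp5 : 5 ≤ p) (hgood : V.HasGoodReductionAtPrime p)
    (hap : V.frobeniusTrace p = 0) (hf : IsNewformOf V f) (ϖ : ℚ) {Lη : IwasawaAlgebra p}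
    (hL : IsQuadraticBranchPlusLFunction f p ϖ Lη) (hL0 : Lη ≠ 0) :
    (-1 : ℤ) ^ lam Lη = (V.quadraticTwist ((((-1 : ℤ) ^ (p / 2) * p : ℤ)) : ℚ)).rootNumber := by
  have hp2 : p ≠ 2 := by omega
  rw [rootNumber_quadraticTwist_pStar hmod hp2 (not_dvd_level_of_isNewformOf hf hgood)]
  exact neg_one_pow_lam_plus_eq_rootNumber_mul_legendreSym' hp5 hgood hap hf ϖ hL hL0

/-- **`(−1)^{λ(L_p⁻(V, η, X))} = w(V^{(p*)})`** (minus twin). [cite: MazurTateTeitelbaum1986Invent, §I.17] [cite: MurtyMurty1997, Ch. 6 §1]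
[cite: Kobayashi2003, Thm. 3.2, (3.5)] -/
theorem neg_one_pow_lam_minus_eq_rootNumber_twist (hmod : exists_isNewformOf) (hp5 : 5 ≤ p) (hgood : V.HasGoodReductionAtPrime p)
    (hap : V.frobeniusTrace p = 0) (hf : IsNewformOf V f) (ϖ : ℚ) {Lη : IwasawaAlgebra p}
    (hL : IsQuadraticBranchMinusLFunction f p ϖ Lη) (hL0 : Lη ≠ 0) :
    (-1 : ℤ) ^ lam Lη = (V.quadraticTwist ((((-1 : ℤ) ^ (p / 2) * p : ℤ)) : ℚ)).rootNumber := by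
  have hp2 : p ≠ 2 := by omega
  rw [rootNumber_quadraticTwist_pStar hmod hp2 (not_dvd_level_of_isNewformOf hf hgood)]
  exact neg_one_pow_lam_minus_eq_rootNumber_mul_legendreSym' hp5 hgood hap hf ϖ hL hL0

/-- **`(−1)^{ord_{T=0} L_p⁺(V, η, X)} = w(V^{(p*)})`**. [cite: GreenbergLNM1716, §5 (p. 181)] [cite: MurtyMurty1997, Ch. 6 §1]
[cite: MazurTateTeitelbaum1986Invent, §I.17] -/
theorem neg_one_pow_order_plus_eq_rootNumber_twist (hmod : exists_isNewformOf) (hp5 : 5 ≤ p) (hgood : V.HasGoodReductionAtPrime p)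
    (hap : V.frobeniusTrace p = 0) (hf : IsNewformOf V f) (ϖ : ℚ) {Lη : IwasawaAlgebra p}
    (hL : IsQuadraticBranchPlusLFunction f p ϖ Lη) (hL0 : Lη ≠ 0) :
    (-1 : ℤ) ^ Lη.order.toNat = (V.quadraticTwist ((((-1 : ℤ) ^ (p / 2) * p : ℤ)) : ℚ)).rootNumber := by
  have hp2 : p ≠ 2 := by omega
  rw [rootNumber_quadraticTwist_pStar hmod hp2 (not_dvd_level_of_isNewformOf hf hgood)]
  exact neg_one_pow_order_plus_eq_rootNumber_mul_legendreSym' hp5 hgood hap hf ϖ hL hL0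

omit hp in
/-- `(−1)^n = w ∈ {±1}` and `(Even r ↔ w = 1)` give `Even n ↔ Even r` (private-free plumbing). [folklore] -/
theorem even_iff_even_of_neg_one_pow_eq {n : ℕ} {w : ℤ} {r : ℕ} (h : (-1 : ℤ) ^ n = w) (hr : Even r ↔ w = 1) : Even n ↔ Even r := by
  rw [hr, ← h, neg_one_pow_eq_one_iff_even (by norm_num)]

/-- **`λ(L_p⁺(V, η, X)) ≡ r_an(V^{(p*)}) (mod 2)`**: the λ-invariant of every nonzero plus branch function is even iff the analytic rank
of the additive twist `V^{(p*)}` is even — Modularity `hmod` only (twisting law + the parity consequence of the complex functional equation,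
`even_analyticRank_iff_rootNumber_eq_one_of_exists_isNewformOf`). [cite: SilvermanAEC2009, C.16 Thm. 16.3 and remark (p. 451)]
[cite: GreenbergLNM1716, §5 (p. 181)] [cite: MurtyMurty1997, Ch. 6 §1] -/
theorem even_lam_plus_iff_even_analyticRank_twist (hmod : exists_isNewformOf) (hp5 : 5 ≤ p) (hgood : V.HasGoodReductionAtPrime p)
    (hap : V.frobeniusTrace p = 0) (hf : IsNewformOf V f) (ϖ : ℚ) {Lη : IwasawaAlgebra p}
    (hL : IsQuadraticBranchPlusLFunction f p ϖ Lη) (hL0 : Lη ≠ 0) :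
    Even (lam Lη) ↔ Even (V.quadraticTwist ((((-1 : ℤ) ^ (p / 2) * p : ℤ)) : ℚ)).analyticRank := by
  have hP : p.Prime := hp.out
  have hDq : ((((-1 : ℤ) ^ (p / 2) * p : ℤ)) : ℚ) ≠ 0 := by
    exact_mod_cast mul_ne_zero (pow_ne_zero _ (neg_ne_zero.mpr one_ne_zero)) (Int.natCast_ne_zero.mpr hP.ne_zero)
  haveI := V.isElliptic_quadraticTwist hDq
  exact even_iff_even_of_neg_one_pow_eq (neg_one_pow_lam_plus_eq_rootNumber_twist hmod hp5 hgood hap hf ϖ hL hL0)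
    (even_analyticRank_iff_rootNumber_eq_one_of_exists_isNewformOf _ hmod)

/-- **`λ(L_p⁻(V, η, X)) ≡ r_an(V^{(p*)}) (mod 2)`** (minus twin; Modularity only). [cite: SilvermanAEC2009, C.16 Thm. 16.3 and remark (p. 451)]
[cite: GreenbergLNM1716, §5 (p. 181)] -/
theorem even_lam_minus_iff_even_analyticRank_twist (hmod : exists_isNewformOf) (hp5 : 5 ≤ p) (hgood : V.HasGoodReductionAtPrime p)
    (hap : V.frobeniusTrace p = 0) (hf : IsNewformOf V f) (ϖ : ℚ) {Lη : IwasawaAlgebra p}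
    (hL : IsQuadraticBranchMinusLFunction f p ϖ Lη) (hL0 : Lη ≠ 0) :
    Even (lam Lη) ↔ Even (V.quadraticTwist ((((-1 : ℤ) ^ (p / 2) * p : ℤ)) : ℚ)).analyticRank := by
  have hP : p.Prime := hp.out
  have hDq : ((((-1 : ℤ) ^ (p / 2) * p : ℤ)) : ℚ) ≠ 0 := by
    exact_mod_cast mul_ne_zero (pow_ne_zero _ (neg_ne_zero.mpr one_ne_zero)) (Int.natCast_ne_zero.mpr hP.ne_zero)
  haveI := V.isElliptic_quadraticTwist hDq
  exact even_iff_even_of_neg_one_pow_eq (neg_one_pow_lam_minus_eq_rootNumber_twist hmod hp5 hgood hap hf ϖ hL hL0)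
    (even_analyticRank_iff_rootNumber_eq_one_of_exists_isNewformOf _ hmod)

/-- **`ord_{T=0} L_p⁺(V, η, X) ≡ r_an(V^{(p*)}) (mod 2)`**: the `p`-adic order of vanishing on the quadratic branch and the complex order of
vanishing of the additive twist agree modulo `2` (Modularity only) — the barrier `PAdicFunctionalEquationSeesOnlyParity` is exactly what a
functional equation gives. [cite: GreenbergLNM1716, §5 (p. 181: "the 'signs' … are the same")] [cite: SilvermanAEC2009, C.16 Thm. 16.3 and remark (p. 451)] -/
theorem even_order_plus_iff_even_analyticRank_twist (hmod : exists_isNewformOf) (hp5 : 5 ≤ p) (hgood : V.HasGoodReductionAtPrime p)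
    (hap : V.frobeniusTrace p = 0) (hf : IsNewformOf V f) (ϖ : ℚ) {Lη : IwasawaAlgebra p}
    (hL : IsQuadraticBranchPlusLFunction f p ϖ Lη) (hL0 : Lη ≠ 0) :
    Even Lη.order.toNat ↔ Even (V.quadraticTwist ((((-1 : ℤ) ^ (p / 2) * p : ℤ)) : ℚ)).analyticRank := by
  have hP : p.Prime := hp.out
  have hDq : ((((-1 : ℤ) ^ (p / 2) * p : ℤ)) : ℚ) ≠ 0 := by
    exact_mod_cast mul_ne_zero (pow_ne_zero _ (neg_ne_zero.mpr one_ne_zero)) (Int.natCast_ne_zero.mpr hP.ne_zero)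
  haveI := V.isElliptic_quadraticTwist hDq
  exact even_iff_even_of_neg_one_pow_eq (neg_one_pow_order_plus_eq_rootNumber_twist hmod hp5 hgood hap hf ϖ hL hL0)
    (even_analyticRank_iff_rootNumber_eq_one_of_exists_isNewformOf _ hmod)

/-- **`r_an(V^{(p*)})` odd ⇒ `L_p⁺(V, η, 0) = 0`** for every plus branch function (the `p`-adic functional equation sees the forced central
zero of `L(V^{(p*)}, s)`; Modularity only). [cite: Kobayashi2003, (3.6) (p. 7)] [cite: SilvermanAEC2009, C.16 Thm. 16.3 and remark (p. 451)]
[cite: MazurTateTeitelbaum1986Invent, §I.17] -/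
theorem constantCoeff_plus_eq_zero_of_odd_analyticRank_twist (hmod : exists_isNewformOf) (hp5 : 5 ≤ p)
    (hgood : V.HasGoodReductionAtPrime p) (hap : V.frobeniusTrace p = 0) (hf : IsNewformOf V f)
    (hodd : Odd (V.quadraticTwist ((((-1 : ℤ) ^ (p / 2) * p : ℤ)) : ℚ)).analyticRank) (ϖ : ℚ) {Lη : IwasawaAlgebra p}
    (hL : IsQuadraticBranchPlusLFunction f p ϖ Lη) : PowerSeries.constantCoeff Lη = 0 := by
  have hP : p.Prime := hp.out
  have hp2 : p ≠ 2 := by omega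
  have hDq : ((((-1 : ℤ) ^ (p / 2) * p : ℤ)) : ℚ) ≠ 0 := by
    exact_mod_cast mul_ne_zero (pow_ne_zero _ (neg_ne_zero.mpr one_ne_zero)) (Int.natCast_ne_zero.mpr hP.ne_zero)
  haveI := V.isElliptic_quadraticTwist hDq
  have hpar := even_analyticRank_iff_rootNumber_eq_one_of_exists_isNewformOf
    (V.quadraticTwist ((((-1 : ℤ) ^ (p / 2) * p : ℤ)) : ℚ)) hmod
  have hw : (V.quadraticTwist ((((-1 : ℤ) ^ (p / 2) * p : ℤ)) : ℚ)).rootNumber = -1 := by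
    rcases (V.quadraticTwist ((((-1 : ℤ) ^ (p / 2) * p : ℤ)) : ℚ)).rootNumber_eq_one_or with h | h
    · exact absurd (hpar.mpr h) (Nat.not_even_iff_odd.mpr hodd)
    · exact h
  rw [rootNumber_quadraticTwist_pStar hmod hp2 (not_dvd_level_of_isNewformOf hf hgood)] at hw
  exact constantCoeff_plus_eq_zero_of_rootNumber_mul_legendreSym_eq_neg_one' hp5 hgood hap hf hw ϖ hL

end Twist

end Summit.BirchSwinnertonDyer.BirchSwinnertonDyer.Theorems.EtaThetaFunctionalEquation

end
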